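import Summits.Schanuel.Schanuel.Theorems.DiophantineDichotomyApproximationPropertySliceOne
import Summits.Schanuel.Schanuel.Theorems.DiophantineDichotomyApproximationPropertyTernaryBox
import Summits.Schanuel.Schanuel.Theorems.DiophantineDichotomyApproximationPropertySmallPrimeCurve
import Summits.Schanuel.Schanuel.Theorems.DiophantineDichotomyApproximationPropertyBoxModCurve
import Summits.Schanuel.Schanuel.Theorems.DiophantineDichotomyApproximationPropertyCIDecomposition
import Summits.Schanuel.Schanuel.Theorems.DiophantineDichotomyApproximationPropertyCIInterpolation
import Summits.Schanuel.Schanuel.Theorems.DiophantineDichotomyApproximationPropertyCycleAPITwo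

/-!
# The `t = 2` slice of the crux `ApproximationProperty` from line `orbit-interpolation-determinant` (stmt-Schanuel-6117)

Route `DiophantineDichotomy` (sub-problem `Schanuel/Schanuel`), crux stmt-Schanuel-6117
`Summit.Schanuel.Schanuel.Theses.DiophantineDichotomy.ApproximationProperty` (Philippon's approximation
property in transcendence degree `t`, all `t ≥ 1`). This file composes the LANDED stubs of the line into
the crux's slice at `t = 2`, UNCONDITIONALLY:

* `cycleAPIAt_two : CycleAPIAt 2` — Philippon's 0-cycle approximation property with interpolation
  control in `ℙ²` (AP1 with `d' = 0`, `n = 2`, J. Number Theory 81 (2000) 234–253; LNM 1752 Ch. 4 §4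
  p. 61), kernel-checked from Dirichlet's box principle for ternary forms (`stub_ternaryBox`), the small
  irreducible plane curve (`stub_smallPrimeCurve`), the box principle modulo that curve
  (`stub_boxModCurve`), Nesterenko's metric Bézout inequality LNM 1752 Ch. 3 Prop. 4.11 with an
  adaptive height (`stub_cycleAPI_two_of`), and the interpolation clause for Galois orbits on a plane
  complete intersection (`stub_ciDecomposition`, `stub_ciInterpolation`);
* `slice_two : PointwiseAPSlice 2` — for every finite `ι` and every `θ ∈ ℂ^ι` with
  `trdeg_ℚ ℚ(θ) ≤ 2` there is `c = c(θ) ≥ 1` such that for all `Y ≥ Δ ≥ c` some algebraic `γ ∈ ℚ̄^ι`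
  with `[ℚ(γ):ℚ] ≤ d ≤ (cΔ)²`, certificates of naive height `H`, `log H ≤ c Y Δ`, has
  `‖γ − θ‖ ≤ exp(−(log H · Δ + d · Y)/c)` — the crux verbatim at exponent `2` (Philippon 2000 for
  points of surfaces; the printed frontier, LNM 1752 Ch. 4 §4: AP2 "also proved for `n = 1, 2`"),
  through the landed `CycleAPIAt 1` (Dirichlet), the dictionary, the lever `OrbitClusterBound`, the
  transfer `SharpClosestPoint`, the pigeonhole `stub_pointAP` and the lifting `stub_lift`;
* `approximationProperty_trdeg_le_two` — the same, unfolded to the route's vocabulary, in the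
  `Summit.Schanuel.Schanuel.Theorems` namespace.

No named fact is used; the only open input of the crux left is `CycleAPIAt t` for `t ≥ 3` (stub G of
the skeleton: printed for `t = 3`, Philippon's conjecture for `t ≥ 4`).
-/

-- `Summit.Schanuel.Schanuel.…` is the mandated summit/sub-problem namespace (single-conjunct summit):
set_option linter.dupNamespace false

namespace Summit.Schanuel.Schanuel.Cruxes.ApproximationProperty.OrbitInterpolationDeterminant

/-- **Philippon's 0-cycle approximation property with interpolation control in `ℙ²`** (`CycleAPIAt 2`),
from the landed stubs A–F of the line. [cite: NesterenkoPhilippon2001, Ch. 4 §4 (p. 61)] -/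
theorem cycleAPIAt_two : CycleAPIAt 2 :=
  stub_cycleAPI_two_of (stub_smallPrimeCurve stub_ternaryBox) stub_boxModCurve
    (stub_ciInterpolation stub_ciDecomposition)

/-- **The `t = 2` slice of the crux** (registered sub-goal `slice_two`): the approximation property for
every `θ ∈ ℂ^ι` with `trdeg_ℚ ℚ(θ) ≤ 2`, unconditionally — cycle input in `ℙ¹` (Dirichlet) and `ℙ²`
(`cycleAPIAt_two`) + dictionary + transfer + pigeonhole + lifting, all landed.
[cite: NesterenkoPhilippon2001, Ch. 4 §4 (p. 61)] -/
theorem slice_two : PointwiseAPSlice 2 :=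
  stub_lift 2 (by norm_num) fun t₀ h₀ h₀2 =>
    stub_pointAP t₀ h₀ stub_zeroDimDictionary
      (by
        rcases Nat.lt_or_ge t₀ 2 with h | h
        · obtain rfl : t₀ = 1 := by omega
          exact stub_cycleAPI_one
        · obtain rfl : t₀ = 2 := le_antisymm h₀2 h
          exact cycleAPIAt_two)
      (stub_sharpClosestPoint stub_orbitClusterBound stub_zeroDimDictionary)

end Summit.Schanuel.Schanuel.Cruxes.ApproximationProperty.OrbitInterpolationDeterminant

namespace Summit.Schanuel.Schanuel.Theorems

/-- **Philippon's approximation property in transcendence degree `≤ 2`** (the `t = 2` slice of the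
crux `ApproximationProperty` of route DiophantineDichotomy, stmt-Schanuel-6117, written out): for a
finite `ι` and `θ : ι → ℂ` with `trdeg_ℚ ℚ(θ) ≤ 2` there is `c ≥ 1` such that for all reals
`Y ≥ Δ ≥ c` there are `γ : ι → ℂ`, `d H : ℕ` with `[ℚ(γ):ℚ] ≤ d`, every `γᵢ` a root of a non-zero
integer polynomial of degree `≤ d` and height `≤ H`, `d ≤ (cΔ)²`, `log H ≤ c Y Δ`, and
`‖γ − θ‖ ≤ exp(−(log H · Δ + d · Y)/c)`. Philippon, J. Number Theory 81 (2000) for points of `ℙ²`;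
here for all finite `ι`, kernel-checked from the line `orbit-interpolation-determinant`.
[cite: NesterenkoPhilippon2001, Ch. 4 §4 (p. 61)] -/
theorem approximationProperty_trdeg_le_two :
    ∀ (ι : Type) [Fintype ι] (θ : ι → ℂ),
      Algebra.trdeg ℚ ↥(IntermediateField.adjoin ℚ (Set.range θ)) ≤ (2 : Cardinal) →
      ∃ c : ℝ, 1 ≤ c ∧ ∀ Δ Y : ℝ, c ≤ Δ → Δ ≤ Y → ∃ (γ : ι → ℂ) (d H : ℕ),
        Module.finrank ℚ ↥(IntermediateField.adjoin ℚ (Set.range γ)) ≤ d ∧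
        (∀ i, ∃ P : Polynomial ℤ, P ≠ 0 ∧ P.natDegree ≤ d ∧ (∀ k, |P.coeff k| ≤ (H : ℤ)) ∧
          Polynomial.aeval (γ i) P = 0) ∧
        (d : ℝ) ≤ (c * Δ) ^ 2 ∧ Real.log H ≤ c * Y * Δ ∧
        ‖γ - θ‖ ≤ Real.exp (-((Real.log H * Δ + d * Y) / c)) := by
  intro ι _ θ hθ
  obtain ⟨c, hc, hall⟩ :=
    Summit.Schanuel.Schanuel.Cruxes.ApproximationProperty.OrbitInterpolationDeterminant.slice_two ι θ
      (by simpa using hθ)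
  refine ⟨c, hc, fun Δ Y hΔ hY => ?_⟩
  obtain ⟨γ, d, H, h1, h2, h3, h4, h5⟩ := hall Δ Y hΔ hY
  exact ⟨γ, d, H, h1, h2, h3, by simpa using h4, h5⟩

end Summit.Schanuel.Schanuel.Theorems
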